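import Mathlib.Analysis.Normed.Field.Basic
import Mathlib.Analysis.Normed.Group.Ultra
import Mathlib.Analysis.Normed.Module.Basic
import Mathlib.Analysis.Normed.Group.Pointwise
import Mathlib.Topology.MetricSpace.Ultra.Basic
import Mathlib.Topology.MetricSpace.Ultra.Pi
import HarnessLib

/-!
# The scaling stabiliser of an off-centre ball in an ultrametric normed space

Topic `Topology/Algebra`; namespace `Literature.Topology.Algebra` with the grouping sub-namespace
`UltrametricBall` (it names the object). Let `F` be a field with a non-archimedean (ultrametric)
absolute value (`[NormedField F] [IsUltrametricDist F]`), `ι` a finite index type, `ι → F` with the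
sup norm, and `D = closedBall x₀ r` a closed ball that does NOT contain `0`, i.e. `r < ‖x₀‖`
(over a local field: `D = x₀ + ϖ^N 𝒪^ι` with `N > ord x₀ := min_j ord (x₀ j)`). The homotheties
`x ↦ y • x`, `y ∈ F`, act on such balls with a clean dichotomy governed by the
**scaling stabiliser**

  `U1 x₀ r := {y : F | ‖(y - 1) • x₀‖ ≤ r}`  (`= closedBall 1 (r / ‖x₀‖)`, `U1_eq_closedBall`):

* `U1 x₀ r` consists of norm-one elements (`norm_eq_one_of_mem_U1`), is a subgroup
  (`one_mem_U1`, `mul_mem_U1`, `inv_mem_U1`) and is open (`isOpen_U1`);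
* for `y ∈ U1 x₀ r`:  `y • D = D` (`smul_ball_eq_of_mem_U1`) and `D ∩ (y • ·)⁻¹ D = D`
  (`ball_inter_preimage_smul_of_mem_U1`);
* for `y ∉ U1 x₀ r`:  `y • D` and `D` are disjoint (`disjoint_smul_ball_of_not_mem_U1`) and
  `D ∩ (y • ·)⁻¹ D = ∅` (`ball_inter_preimage_smul_of_not_mem_U1`); the key step is
  `mem_U1_of_smul_mem_ball`: if `d ∈ D` and `y • d ∈ D` then `y ∈ U1 x₀ r` (compare absolute
  values to get `‖y‖ = 1`, then first digits).

This is the standard "balls are either equal or disjoint" geometry of ultrametric spaces applied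
to the multiplicative action (e.g. J. W. S. Cassels, *Local Fields* (1986), Ch. 2 §1 and Ch. 4;
N. Bourbaki, *Commutative Algebra*, Ch. VI §5); everything is proved from Mathlib
(`IsUltrametricDist.norm_add_le_max`, `IsUltrametricDist.norm_add_eq_max_of_norm_ne_norm`,
`IsUltrametricDist.isOpen_closedBall`). In harmonic analysis on `Fˣ ↷ F^ι` it is the computation
behind `⟨𝟙_D, 𝟙_D ∘ (y • ·)⟩ = vol(D) · 𝟙_{U1}(y)`, i.e. the matrix coefficient of the indicator of an
off-centre ball under dilations is `vol(D)` times the indicator of an open compact subgroup.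
Novelty check (`lean search --decl`, 2026-08-18): no stabiliser-of-a-ball declaration in Mathlib or
the tree; neighbours are `Literature/Topology/Algebra/UnitsNonarchimedean.lean` (open subgroups of
`𝒪ˣ`) and `Literature.NumberTheory.Automorphic.unitFiltration` (`U^n_F` of a local field) — different
objects. Deliberately NOT here: measures / volumes (the `L²` consequences live with their users).

## Provenance

Reproduced for the tree under the LEAN-IN-TREE rule (2026-08-18) from the pub-hodgecm cell's
package file `HodgeCM/PerL34/LocalFactors/BallDichotomy.lean` (DAG-node prover #07 lineage, seat
pv07 gen 1, gate run 19; 236 lines, 16 declarations), verbatim up to the enclosing namespace, the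
import list (was `import Mathlib`) and the added docstrings / tags; port by seat pv07 gen 5.
-/

set_option autoImplicit false

namespace Literature.Topology.Algebra

namespace UltrametricBall

open Metric Set
open scoped Pointwise

variable {F : Type*} [NormedField F] [IsUltrametricDist F]
variable {ι : Type*} [Fintype ι]

/-- The scaling stabiliser `U1 x₀ r := {y : F | ‖(y - 1) • x₀‖ ≤ r}` of the ball `closedBall x₀ r`
in `ι → F` (sup norm); for `x₀ ≠ 0` it is `closedBall 1 (r / ‖x₀‖)` (`U1_eq_closedBall`). Over a
local field with `closedBall 0 r = ϖ^N 𝒪^ι` this is `{y | (y - 1) x₀ ∈ ϖ^N 𝒪^ι}`. [folklore] -/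
def U1 (x₀ : ι → F) (r : ℝ) : Set F := {y : F | ‖(y - 1) • x₀‖ ≤ r}

omit [IsUltrametricDist F] in
/-- Membership in the scaling stabiliser, by definition. [folklore] -/
theorem mem_U1 {x₀ : ι → F} {r : ℝ} {y : F} : y ∈ U1 x₀ r ↔ ‖(y - 1) • x₀‖ ≤ r := Iff.rfl

/-- "First digits": every point `d` of a ball `closedBall x₀ r` with `r < ‖x₀‖` has `‖d‖ = ‖x₀‖`.
[folklore] -/
theorem norm_eq_of_mem_ball {x₀ d : ι → F} {r : ℝ} (hr : r < ‖x₀‖)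
    (hd : d ∈ closedBall x₀ r) : ‖d‖ = ‖x₀‖ := by
  rw [mem_closedBall, dist_eq_norm] at hd
  have hne : ‖x₀‖ ≠ ‖d - x₀‖ := by
    intro h
    rw [← h] at hd
    exact absurd hd (not_le.mpr hr)
  have key := IsUltrametricDist.norm_add_eq_max_of_norm_ne_norm hne
  have hsum : x₀ + (d - x₀) = d := by abel
  rw [hsum] at key
  rw [key, max_eq_left]
  exact le_of_lt (lt_of_le_of_lt hd hr)

/-- The scaling stabiliser consists of norm-one elements: `y ∈ U1 x₀ r → ‖y‖ = 1` (for
`r < ‖x₀‖`). [folklore] -/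
theorem norm_eq_one_of_mem_U1 {x₀ : ι → F} {r : ℝ} (hr : r < ‖x₀‖) {y : F}
    (hy : y ∈ U1 x₀ r) : ‖y‖ = 1 := by
  rw [mem_U1, norm_smul] at hy
  have hx : 0 < ‖x₀‖ := lt_of_le_of_lt (le_trans (by positivity) hy) hr
  have h1 : ‖y - 1‖ < 1 := by
    refine lt_of_not_ge fun h => ?_
    have : ‖x₀‖ ≤ ‖y - 1‖ * ‖x₀‖ := le_mul_of_one_le_left (norm_nonneg _) h
    exact absurd (lt_of_le_of_lt (le_trans this hy) hr) (lt_irrefl _)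
  have hne : ‖(1 : F)‖ ≠ ‖y - 1‖ := by
    rw [norm_one]
    exact ne_of_gt h1
  have key := IsUltrametricDist.norm_add_eq_max_of_norm_ne_norm hne
  have hsum : (1 : F) + (y - 1) = y := by abel
  rw [hsum, norm_one, max_eq_left h1.le] at key
  exact key

/-- Elements of the scaling stabiliser are non-zero (for `r < ‖x₀‖`). [folklore] -/
theorem ne_zero_of_mem_U1 {x₀ : ι → F} {r : ℝ} (hr : r < ‖x₀‖) {y : F}
    (hy : y ∈ U1 x₀ r) : y ≠ 0 := by
  intro h
  have := norm_eq_one_of_mem_U1 hr hy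
  rw [h, norm_zero] at this
  exact zero_ne_one this

omit [IsUltrametricDist F] in
/-- The scaling stabiliser is a subgroup: `1 ∈ U1 x₀ r` (any `r ≥ 0`). [folklore] -/
theorem one_mem_U1 {x₀ : ι → F} {r : ℝ} (hr0 : 0 ≤ r) : (1 : F) ∈ U1 x₀ r := by
  rw [mem_U1, sub_self, zero_smul, norm_zero]
  exact hr0

/-- The scaling stabiliser is a subgroup: closed under multiplication. [folklore] -/
theorem mul_mem_U1 {x₀ : ι → F} {r : ℝ} (hr : r < ‖x₀‖) {y z : F} (hy : y ∈ U1 x₀ r)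
    (hz : z ∈ U1 x₀ r) : y * z ∈ U1 x₀ r := by
  have hy1 := norm_eq_one_of_mem_U1 hr hy
  rw [mem_U1] at hy hz ⊢
  have hdec : (y * z - 1) • x₀ = y • ((z - 1) • x₀) + (y - 1) • x₀ := by
    rw [smul_smul, ← add_smul]
    congr 1
    ring
  rw [hdec]
  calc ‖y • ((z - 1) • x₀) + (y - 1) • x₀‖
      ≤ max ‖y • ((z - 1) • x₀)‖ ‖(y - 1) • x₀‖ := IsUltrametricDist.norm_add_le_max _ _
    _ ≤ r := by
        rw [norm_smul, hy1, one_mul]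
        exact max_le hz hy

/-- The scaling stabiliser is a subgroup: closed under inversion. [folklore] -/
theorem inv_mem_U1 {x₀ : ι → F} {r : ℝ} (hr : r < ‖x₀‖) {y : F} (hy : y ∈ U1 x₀ r) :
    y⁻¹ ∈ U1 x₀ r := by
  have hy1 := norm_eq_one_of_mem_U1 hr hy
  have hy0 := ne_zero_of_mem_U1 hr hy
  rw [mem_U1] at hy ⊢
  have halg : y⁻¹ - 1 = -y⁻¹ * (y - 1) := by
    rw [neg_mul, mul_sub, inv_mul_cancel₀ hy0, mul_one, neg_sub]
  rw [halg, ← smul_smul, norm_smul, norm_neg, norm_inv, hy1, inv_one, one_mul]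
  exact hy

omit [IsUltrametricDist F] in
/-- The scaling stabiliser is the closed ball `closedBall 1 (r / ‖x₀‖)` (for `x₀ ≠ 0`).
[folklore] -/
theorem U1_eq_closedBall {x₀ : ι → F} (hx : x₀ ≠ 0) (r : ℝ) :
    U1 x₀ r = closedBall (1 : F) (r / ‖x₀‖) := by
  have hx' : 0 < ‖x₀‖ := norm_pos_iff.mpr hx
  ext y
  rw [mem_U1, mem_closedBall, dist_eq_norm, norm_smul, le_div_iff₀ hx']

/-- The scaling stabiliser is open, for any radius `r > 0` (closed balls of positive radius are
open in an ultrametric space). [folklore] -/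
theorem isOpen_U1 {x₀ : ι → F} {r : ℝ} (hr0 : 0 < r) : IsOpen (U1 x₀ r) := by
  by_cases hx : x₀ = 0
  · have hall : U1 x₀ r = univ := by
      ext y
      simp only [mem_U1, hx, smul_zero, norm_zero, mem_univ, iff_true]
      exact hr0.le
    rw [hall]
    exact isOpen_univ
  · rw [U1_eq_closedBall hx]
    exact IsUltrametricDist.isOpen_closedBall _ (div_pos hr0 (norm_pos_iff.mpr hx)).ne'

/-- For `y` in the scaling stabiliser, `y • D ⊆ D` (`D = closedBall x₀ r`, `r < ‖x₀‖`). [folklore] -/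
theorem smul_ball_subset_of_mem_U1 {x₀ : ι → F} {r : ℝ} (hr : r < ‖x₀‖) {y : F}
    (hy : y ∈ U1 x₀ r) : y • closedBall x₀ r ⊆ closedBall x₀ r := by
  have hy1 := norm_eq_one_of_mem_U1 hr hy
  rw [mem_U1] at hy
  intro z hz
  obtain ⟨d, hd, rfl⟩ := mem_smul_set.mp hz
  rw [mem_closedBall, dist_eq_norm] at hd ⊢
  have hdec : y • d - x₀ = y • (d - x₀) + (y - 1) • x₀ := by
    rw [smul_sub, sub_smul, one_smul]
    abel
  rw [hdec]
  calc ‖y • (d - x₀) + (y - 1) • x₀‖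
      ≤ max ‖y • (d - x₀)‖ ‖(y - 1) • x₀‖ := IsUltrametricDist.norm_add_le_max _ _
    _ ≤ r := by
        rw [norm_smul, hy1, one_mul]
        exact max_le hd hy

/-- For `y` in the scaling stabiliser, `y • D = D` (`D = closedBall x₀ r`, `r < ‖x₀‖`). [folklore] -/
theorem smul_ball_eq_of_mem_U1 {x₀ : ι → F} {r : ℝ} (hr : r < ‖x₀‖) {y : F}
    (hy : y ∈ U1 x₀ r) : y • closedBall x₀ r = closedBall x₀ r := by
  refine (smul_ball_subset_of_mem_U1 hr hy).antisymm ?_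
  intro d hd
  have hy0 := ne_zero_of_mem_U1 hr hy
  refine mem_smul_set.mpr ⟨y⁻¹ • d, ?_, by rw [smul_smul, mul_inv_cancel₀ hy0, one_smul]⟩
  exact smul_ball_subset_of_mem_U1 hr (inv_mem_U1 hr hy) (smul_mem_smul_set hd)

/-- The two-case argument: if `d ∈ D` and `y • d ∈ D` (`D = closedBall x₀ r`, `r < ‖x₀‖`) then `y`
lies in the scaling stabiliser — comparing absolute values gives `‖y‖ = 1`, comparing first digits
gives `‖(y - 1) • x₀‖ ≤ r`. [folklore] -/
theorem mem_U1_of_smul_mem_ball {x₀ : ι → F} {r : ℝ} (hr : r < ‖x₀‖) {y : F} {d : ι → F}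
    (hd : d ∈ closedBall x₀ r) (hyd : y • d ∈ closedBall x₀ r) : y ∈ U1 x₀ r := by
  -- compare absolute values: `|y| = 1`
  have h1 : ‖d‖ = ‖x₀‖ := norm_eq_of_mem_ball hr hd
  have h2 : ‖y • d‖ = ‖x₀‖ := norm_eq_of_mem_ball hr hyd
  rw [mem_closedBall, dist_eq_norm] at hd hyd
  have hx : 0 < ‖x₀‖ := lt_of_le_of_lt (le_trans (norm_nonneg _) hd) hr
  rw [norm_smul, h1] at h2
  have hy1 : ‖y‖ = 1 := by
    have h3 : ‖y‖ * ‖x₀‖ = 1 * ‖x₀‖ := by rw [h2, one_mul]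
    exact mul_right_cancel₀ hx.ne' h3
  -- first digits: `(y − 1) • x₀ = (y • d − x₀) − y • (d − x₀)` has norm `≤ r`
  rw [mem_U1]
  have hdec : (y - 1) • x₀ = (y • d - x₀) + -(y • (d - x₀)) := by
    rw [sub_smul, one_smul, smul_sub]
    abel
  rw [hdec]
  calc ‖(y • d - x₀) + -(y • (d - x₀))‖
      ≤ max ‖y • d - x₀‖ ‖-(y • (d - x₀))‖ := IsUltrametricDist.norm_add_le_max _ _
    _ ≤ r := by
        rw [norm_neg, norm_smul, hy1, one_mul]
        exact max_le hyd hd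

/-- For `y` outside the scaling stabiliser, `y • D` and `D` are disjoint (`D = closedBall x₀ r`,
`r < ‖x₀‖`). [folklore] -/
theorem disjoint_smul_ball_of_not_mem_U1 {x₀ : ι → F} {r : ℝ} (hr : r < ‖x₀‖) {y : F}
    (hy : y ∉ U1 x₀ r) : Disjoint (y • closedBall x₀ r) (closedBall x₀ r) := by
  rw [Set.disjoint_left]
  intro z hz hz'
  obtain ⟨d, hd, rfl⟩ := mem_smul_set.mp hz
  exact hy (mem_U1_of_smul_mem_ball hr hd hz')

/-- `D ∩ (y • ·)⁻¹ D = D` for `y` in the scaling stabiliser (`D = closedBall x₀ r`, `r < ‖x₀‖`); with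
the next lemma this is the set identity behind "the matrix coefficient of `𝟙_D` under dilations is
`vol(D) · 𝟙_{U1}`". [folklore] -/
theorem ball_inter_preimage_smul_of_mem_U1 {x₀ : ι → F} {r : ℝ} (hr : r < ‖x₀‖) {y : F}
    (hy : y ∈ U1 x₀ r) :
    closedBall x₀ r ∩ (fun x => y • x) ⁻¹' closedBall x₀ r = closedBall x₀ r := by
  apply inter_eq_left.mpr
  intro d hd
  exact smul_ball_subset_of_mem_U1 hr hy (smul_mem_smul_set hd)

/-- `D ∩ (y • ·)⁻¹ D = ∅` for `y` outside the scaling stabiliser (`D = closedBall x₀ r`,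
`r < ‖x₀‖`). [folklore] -/
theorem ball_inter_preimage_smul_of_not_mem_U1 {x₀ : ι → F} {r : ℝ} (hr : r < ‖x₀‖) {y : F}
    (hy : y ∉ U1 x₀ r) :
    closedBall x₀ r ∩ (fun x => y • x) ⁻¹' closedBall x₀ r = ∅ := by
  ext d
  simp only [mem_inter_iff, mem_preimage, mem_empty_iff_false, iff_false, not_and]
  intro hd hyd
  exact hy (mem_U1_of_smul_mem_ball hr hd hyd)

end UltrametricBall

end Literature.Topology.Algebra
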